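import Literature.Topology.FourManifolds.ClosedBallProofs
import Literature.Topology.FourManifolds.ClosedBallSmoothMaps
import Literature.Topology.FourManifolds.ImmersionCriterion
import HarnessLib

/-!
# Discs with boundary cut out of immersions: `F|𝔻ⁿ⁺¹` is a smooth embedding of `𝔻ⁿ⁺¹`

General infrastructure for the manifold with boundary `𝔻ⁿ⁺¹ = closedBall 0 1 ⊆ ℝⁿ⁺¹`
(`Literature.Topology.FourManifolds.instChartedSpaceClosedBall`, model `𝓡∂ (n + 1)`,
`ClosedBall.lean`). The tree presents compact surfaces with boundary by smooth maps on the ambient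
Euclidean space restricted to `𝔻` (`Knot.IsSliceDisc`, `Knot.IsSliceDiscIn`: "`f : ℝ² → X` is
`C^∞`, injective and immersive on `𝔻²`"), whereas Mathlib's isotopy / embedding notions
(`Manifold.IsSmoothEmbedding`, used by `Literature.Topology.FourManifolds.SmoothIsotopy` and the
isotopy extension theorem `SmoothIsotopy.exists_ambientIsotopy_comp_eq_holds`) are chart
properties of the map *on the manifold with boundary* `𝔻ⁿ⁺¹`. This file bridges the two in
arbitrary codimension (the equidimensional case of partial diffeomorphisms is
`Literature.Geometry.Symplectic.isSmoothEmbedding_comp_coe_closedBall`):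

* `isImmersionAtOfComplement_comp_coe_closedBall_of_charts` — if `F : ℝⁿ⁺¹ → N` is a Mathlib
  immersion at `x ∈ 𝔻ⁿ⁺¹` (as a map of the boundaryless `ℝⁿ⁺¹`, complement `Fᶜ`), then
  `F ∘ Subtype.val : 𝔻ⁿ⁺¹ → N` is an immersion at `x` for the model with boundary `𝓡∂ (n + 1)`,
  with the same complement: given immersion charts `φ` (of `ℝⁿ⁺¹` at `x`), `ψ` (of `N`) and
  `L : ℝⁿ⁺¹ × Fᶜ ≃ ℝᵐ` with `ψ ∘ F ∘ φ⁻¹ = L (·, 0)`, and an atlas chart `e` of `𝔻ⁿ⁺¹` at `x`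
  whose inverse is the restriction of a partial diffeomorphism `D⁻¹` of `ℝⁿ⁺¹` (the translation
  for the interior chart, the polar chart `polarChart` for the boundary charts, exactly as in
  `ClosedBallProofs.lean`), the codomain chart `ψ` followed by the partial diffeomorphism
  `L ∘ ((D ∘ φ⁻¹) × id) ∘ L⁻¹` of `ℝᵐ` exhibits `F ∘ Subtype.val` as `L (·, 0)` in the chart `e`
  restricted to `F⁻¹`-compatible points;
* `isImmersionAtOfComplement_comp_coe_closedBall` — the same without chart data (interior and
  boundary points);
* `isImmersion_comp_coe_closedBall_of_injective_mfderiv`,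
  `isSmoothEmbedding_comp_coe_closedBall_of_injective_mfderiv` — **if `F : ℝⁿ⁺¹ → N` is `C^∞`
  with injective differential at every point of `𝔻ⁿ⁺¹` (and injective on `𝔻ⁿ⁺¹`), then
  `F|𝔻ⁿ⁺¹ : 𝔻ⁿ⁺¹ → N` is an immersion (a smooth embedding) of the manifold with boundary**, via
  the immersion criterion `isImmersionAtOfComplement_of_injective_mfderiv`
  (`ImmersionCriterion.lean`, complement `ℝᵏ`, `k = m - (n + 1)`).

Targets `N` are manifolds modelled on `EuclideanSpace ℝ (Fin m)` (`𝓡 m`, no boundary), as all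
consumers in the topic. Everything is proved; no named facts, no definitions.

## References

* J. M. Lee, *Introduction to Smooth Manifolds*, 2nd ed., GTM 218 (2013), Ch. 4 (immersions,
  Thm. 4.12) and Ch. 5 (Prop. 5.22; regular domains, Prop. 5.47) [LeeSmoothManifolds2013].
* M. W. Hirsch, *Differential Topology*, GTM 33 (1976), Ch. 1 §3 Thm. 3.1, §1.4 [HirschDT1976].
-/

open scoped Manifold ContDiff Topology
open Set Function Metric

noncomputable section

namespace Literature.Topology.FourManifolds

section ClosedBallImmersion

variable {n m : ℕ} {N : Type*} [TopologicalSpace N] [ChartedSpace (EuclideanSpace ℝ (Fin m)) N]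
  [IsManifold (𝓡 m) ∞ N]
  {Fc : Type*} [NormedAddCommGroup Fc] [NormedSpace ℝ Fc]

/-- **Immersions of `ℝⁿ⁺¹` restrict to immersions of the manifold with boundary `𝔻ⁿ⁺¹`, chart
form.** Let `F : ℝⁿ⁺¹ → N` be a `C^∞` immersion at the point `x ∈ 𝔻ⁿ⁺¹` in Mathlib's sense for
the boundaryless source `ℝⁿ⁺¹` (`Manifold.IsImmersionAtOfComplement Fᶜ 𝓘(ℝ, ℝⁿ⁺¹) (𝓡 m)`), and
let `e` be a chart of the atlas of `𝔻ⁿ⁺¹` at `x` together with a partial diffeomorphism `D` of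
`ℝⁿ⁺¹` whose inverse extends `e⁻¹` on `e.target`, with `x ∈ D.source` (the data of
`isImmersionAtOfComplement_hemisphereMap_of_charts`). Then `F ∘ Subtype.val : 𝔻ⁿ⁺¹ → N` is an
immersion at `x` for `𝓡∂ (n + 1)` with the same complement: if `φ, ψ, L` are immersion charts of
`F` at `x` (`ψ ∘ F ∘ φ⁻¹ = L (·, 0)`), the codomain chart `ψ ≫ (L ∘ ((φ⁻¹ ≫ D) × id) ∘ L⁻¹)` and
the domain chart `e` restricted to `Subtype.val ⁻¹' φ.source` exhibit `F ∘ Subtype.val` as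
`L (·, 0)`. (Lee 2013, Ch. 4–5: restriction of an immersion to a regular domain.)
[cite: LeeSmoothManifolds2013, Ch. 4 Thm. 4.12 and Ch. 5 Prop. 5.22] -/
theorem isImmersionAtOfComplement_comp_coe_closedBall_of_charts
    {F : EuclideanSpace ℝ (Fin (n + 1)) → N}
    {x : Metric.closedBall (0 : EuclideanSpace ℝ (Fin (n + 1))) 1}
    (hF : Manifold.IsImmersionAtOfComplement Fc 𝓘(ℝ, EuclideanSpace ℝ (Fin (n + 1))) (𝓡 m) ∞ F
      (x : EuclideanSpace ℝ (Fin (n + 1))))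
    (e : OpenPartialHomeomorph (Metric.closedBall (0 : EuclideanSpace ℝ (Fin (n + 1))) 1)
      (EuclideanHalfSpace (n + 1)))
    (he : e ∈ atlas (EuclideanHalfSpace (n + 1))
      (Metric.closedBall (0 : EuclideanSpace ℝ (Fin (n + 1))) 1))
    (hx : x ∈ e.source)
    (D : OpenPartialHomeomorph (EuclideanSpace ℝ (Fin (n + 1))) (EuclideanSpace ℝ (Fin (n + 1))))
    (hD : ContDiffOn ℝ ∞ D D.source) (hD' : ContDiffOn ℝ ∞ D.symm D.target)
    (hxD : (x : EuclideanSpace ℝ (Fin (n + 1))) ∈ D.source)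
    (htarget : ∀ z ∈ e.target, z.val ∈ D.target)
    (hsymm : ∀ z ∈ e.target,
      ((e.symm z : Metric.closedBall (0 : EuclideanSpace ℝ (Fin (n + 1))) 1) :
        EuclideanSpace ℝ (Fin (n + 1))) = D.symm z.val) :
    Manifold.IsImmersionAtOfComplement Fc (𝓡∂ (n + 1)) (𝓡 m) ∞
      (F ∘ Subtype.val : Metric.closedBall (0 : EuclideanSpace ℝ (Fin (n + 1))) 1 → N) x := by
  -- the immersion charts of `F` at `x`
  set φ := hF.domChart with hφ
  set ψ := hF.codChart with hψ
  set L := hF.equiv with hL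
  have hxφ : (x : EuclideanSpace ℝ (Fin (n + 1))) ∈ φ.source := hF.mem_domChart_source
  have hφatlas : φ ∈ IsManifold.maximalAtlas 𝓘(ℝ, EuclideanSpace ℝ (Fin (n + 1))) ∞
      (EuclideanSpace ℝ (Fin (n + 1))) := hF.domChart_mem_maximalAtlas
  have hψatlas : ψ ∈ IsManifold.maximalAtlas (𝓡 m) ∞ N := hF.codChart_mem_maximalAtlas
  have hsrc : φ.source ⊆ F ⁻¹' ψ.source := hF.source_subset_preimage_source
  -- `ψ (F (φ⁻¹ u)) = L (u, 0)` for `u ∈ φ.target`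
  have hwr : ∀ u ∈ φ.target, ψ (F (φ.symm u)) = L (u, 0) := by
    intro u hu
    have hu' : u ∈ (φ.extend 𝓘(ℝ, EuclideanSpace ℝ (Fin (n + 1)))).target := by
      rw [OpenPartialHomeomorph.extend_target]
      simpa using hu
    have h := hF.writtenInCharts hu'
    simpa [hφ, hψ, hL] using h
  -- smoothness of `φ` and `φ⁻¹`
  have hφs : ContDiffOn ℝ ∞ φ φ.source :=
    contMDiffOn_iff_contDiffOn.1 (contMDiffOn_of_mem_maximalAtlas hφatlas)
  have hφs' : ContDiffOn ℝ ∞ φ.symm φ.target :=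
    contMDiffOn_iff_contDiffOn.1 (contMDiffOn_symm_of_mem_maximalAtlas hφatlas)
  -- the partial diffeomorphism `Θ = L ∘ ((φ⁻¹ ≫ D) × id) ∘ L⁻¹` of `ℝᵐ`
  set Θ₀ : OpenPartialHomeomorph (EuclideanSpace ℝ (Fin (n + 1)) × Fc)
      (EuclideanSpace ℝ (Fin (n + 1)) × Fc) :=
    (φ.symm.trans D).prod (OpenPartialHomeomorph.refl Fc) with hΘ₀
  set Θ : OpenPartialHomeomorph (EuclideanSpace ℝ (Fin m)) (EuclideanSpace ℝ (Fin m)) :=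
    (L.symm.toHomeomorph.toOpenPartialHomeomorph.trans Θ₀).trans
      L.toHomeomorph.toOpenPartialHomeomorph with hΘ
  have hΘapply : ∀ p, Θ p = L (D (φ.symm (L.symm p).1), (L.symm p).2) := fun p => rfl
  have hΘsource : Θ.source = {p | (L.symm p).1 ∈ φ.target ∧ φ.symm (L.symm p).1 ∈ D.source} := by
    ext p
    simp [hΘ, hΘ₀]
  have hΘD : ContDiffOn ℝ ∞ Θ Θ.source := by
    rw [hΘsource]
    have h1 : ContDiffOn ℝ ∞ (fun p : EuclideanSpace ℝ (Fin m) => (L.symm p).1)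
        {p | (L.symm p).1 ∈ φ.target ∧ φ.symm (L.symm p).1 ∈ D.source} :=
      (L.symm.contDiff.fst).contDiffOn
    have h2 : ContDiffOn ℝ ∞ (fun p : EuclideanSpace ℝ (Fin m) => φ.symm (L.symm p).1)
        {p | (L.symm p).1 ∈ φ.target ∧ φ.symm (L.symm p).1 ∈ D.source} :=
      hφs'.comp h1 fun p hp => hp.1
    have h3 : ContDiffOn ℝ ∞ (fun p : EuclideanSpace ℝ (Fin m) => D (φ.symm (L.symm p).1))
        {p | (L.symm p).1 ∈ φ.target ∧ φ.symm (L.symm p).1 ∈ D.source} :=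
      hD.comp h2 fun p hp => hp.2
    have h4 : ContDiffOn ℝ ∞ (fun p : EuclideanSpace ℝ (Fin m) => (L.symm p).2)
        {p | (L.symm p).1 ∈ φ.target ∧ φ.symm (L.symm p).1 ∈ D.source} :=
      (L.symm.contDiff.snd).contDiffOn
    exact L.contDiff.comp_contDiffOn (h3.prodMk h4)
  have hΘtarget : Θ.target = {p | (L.symm p).1 ∈ D.target ∧ D.symm (L.symm p).1 ∈ φ.source} := by
    ext p
    simp [hΘ, hΘ₀, and_comm]
  have hΘsymm : ∀ p, Θ.symm p = L (φ (D.symm (L.symm p).1), (L.symm p).2) := fun p => rfl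
  have hΘD' : ContDiffOn ℝ ∞ Θ.symm Θ.target := by
    rw [hΘtarget]
    have h1 : ContDiffOn ℝ ∞ (fun p : EuclideanSpace ℝ (Fin m) => (L.symm p).1)
        {p | (L.symm p).1 ∈ D.target ∧ D.symm (L.symm p).1 ∈ φ.source} :=
      (L.symm.contDiff.fst).contDiffOn
    have h2 : ContDiffOn ℝ ∞ (fun p : EuclideanSpace ℝ (Fin m) => D.symm (L.symm p).1)
        {p | (L.symm p).1 ∈ D.target ∧ D.symm (L.symm p).1 ∈ φ.source} :=
      hD'.comp h1 fun p hp => hp.1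
    have h3 : ContDiffOn ℝ ∞ (fun p : EuclideanSpace ℝ (Fin m) => φ (D.symm (L.symm p).1))
        {p | (L.symm p).1 ∈ D.target ∧ D.symm (L.symm p).1 ∈ φ.source} :=
      hφs.comp h2 fun p hp => hp.2
    have h4 : ContDiffOn ℝ ∞ (fun p : EuclideanSpace ℝ (Fin m) => (L.symm p).2)
        {p | (L.symm p).1 ∈ D.target ∧ D.symm (L.symm p).1 ∈ φ.source} :=
      (L.symm.contDiff.snd).contDiffOn
    refine (L.contDiff.comp_contDiffOn (h3.prodMk h4)).congr fun p _ => hΘsymm p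
  -- the domain chart: `e` restricted to the points over `φ.source`
  have hS : IsOpen (Subtype.val ⁻¹' φ.source :
      Set (Metric.closedBall (0 : EuclideanSpace ℝ (Fin (n + 1))) 1)) :=
    φ.open_source.preimage continuous_subtype_val
  set e' := e.restr (Subtype.val ⁻¹' φ.source) with he'
  have he'atlas : e' ∈ IsManifold.maximalAtlas (𝓡∂ (n + 1)) ∞
      (Metric.closedBall (0 : EuclideanSpace ℝ (Fin (n + 1))) 1) :=
    restr_mem_maximalAtlas _ (IsManifold.subset_maximalAtlas he) hS
  have hxe' : x ∈ e'.source := by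
    rw [he', e.restr_source' _ hS]
    exact ⟨hx, hxφ⟩
  -- `F x` lies in the source of the modified codomain chart
  have hFx : ψ (F x) = L (φ x, 0) := by
    have h := hwr (φ x) (φ.map_source hxφ)
    rwa [φ.left_inv hxφ] at h
  have hfx : (F ∘ Subtype.val) x ∈ (ψ.trans Θ).source := by
    rw [OpenPartialHomeomorph.trans_source, mem_inter_iff, mem_preimage, comp_apply, hΘsource,
      mem_setOf_eq, hFx, ContinuousLinearEquiv.symm_apply_apply, φ.left_inv hxφ]
    exact ⟨hsrc hxφ, φ.map_source hxφ, hxD⟩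
  refine Manifold.IsImmersionAtOfComplement.mk_of_continuousAt ?_ L e' (ψ.trans Θ) hxe' hfx
    he'atlas (trans_mem_maximalAtlas_of_contDiffOn hψatlas Θ hΘD hΘD') ?_
  · exact (hF.continuousAt.comp continuous_subtype_val.continuousAt)
  · intro u hu
    rw [OpenPartialHomeomorph.extend_target] at hu
    obtain ⟨hu, z, rfl⟩ := hu
    rw [mem_preimage, ModelWithCorners.left_inv] at hu
    -- `hu : z ∈ e'.target`, i.e. `z ∈ e.target` and `(e.symm z).val ∈ φ.source`
    have hz : z ∈ e.target ∧ ((e.symm z : Metric.closedBall (0 : EuclideanSpace ℝ (Fin (n + 1))) 1) :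
        EuclideanSpace ℝ (Fin (n + 1))) ∈ φ.source := by
      rw [he'] at hu
      simpa [hS.interior_eq] using hu
    have hw : ((e.symm z : Metric.closedBall (0 : EuclideanSpace ℝ (Fin (n + 1))) 1) :
        EuclideanSpace ℝ (Fin (n + 1))) = D.symm z.val := hsymm z hz.1
    simp only [comp_apply, OpenPartialHomeomorph.extend_coe, OpenPartialHomeomorph.extend_coe_symm,
      ModelWithCorners.left_inv, modelWithCornersSelf_coe, id, OpenPartialHomeomorph.trans_apply,
      he', OpenPartialHomeomorph.restr_symm_apply]
    rw [hw, ← φ.left_inv (show D.symm z.val ∈ φ.source by rw [← hw]; exact hz.2),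
      hwr _ (φ.map_source (show D.symm z.val ∈ φ.source by rw [← hw]; exact hz.2)), hΘapply,
      ContinuousLinearEquiv.symm_apply_apply, φ.left_inv
        (show D.symm z.val ∈ φ.source by rw [← hw]; exact hz.2),
      D.right_inv (htarget z hz.1)]
    rfl

/-- **Immersions of `ℝⁿ⁺¹` restrict to immersions of `𝔻ⁿ⁺¹`** (interior points: interior chart
and the translation `w ↦ w + 2e₀`; boundary points: the boundary chart at `x/‖x‖ = x` and the polar
chart of `ClosedBallProofs.lean`). [cite: LeeSmoothManifolds2013, Ch. 4 Thm. 4.12 and Ch. 5 Prop. 5.22] -/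
theorem isImmersionAtOfComplement_comp_coe_closedBall
    {F : EuclideanSpace ℝ (Fin (n + 1)) → N}
    {x : Metric.closedBall (0 : EuclideanSpace ℝ (Fin (n + 1))) 1}
    (hF : Manifold.IsImmersionAtOfComplement Fc 𝓘(ℝ, EuclideanSpace ℝ (Fin (n + 1))) (𝓡 m) ∞ F
      (x : EuclideanSpace ℝ (Fin (n + 1)))) :
    Manifold.IsImmersionAtOfComplement Fc (𝓡∂ (n + 1)) (𝓡 m) ∞
      (F ∘ Subtype.val : Metric.closedBall (0 : EuclideanSpace ℝ (Fin (n + 1))) 1 → N) x := by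
  by_cases hx1 : ‖(x : EuclideanSpace ℝ (Fin (n + 1)))‖ < 1
  · set D : OpenPartialHomeomorph (EuclideanSpace ℝ (Fin (n + 1)))
        (EuclideanSpace ℝ (Fin (n + 1))) :=
      (Homeomorph.addRight ((2 : ℝ) • closedBallBaseVector n)).toOpenPartialHomeomorph with hD
    refine isImmersionAtOfComplement_comp_coe_closedBall_of_charts hF (closedBallInteriorChart n)
      (mem_insert _ _) hx1 D ?_ ?_ (mem_univ _) (fun z _ => mem_univ _) fun z hz => ?_
    · exact (contDiff_id.add contDiff_const).contDiffOn
    · exact (contDiff_id.sub contDiff_const).contDiffOn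
    · rw [coe_closedBallInteriorChart_symm_apply (le_of_lt hz), hD,
        Homeomorph.toOpenPartialHomeomorph_symm_apply, Homeomorph.addRight_symm,
        Homeomorph.coe_addRight, sub_eq_add_neg]
  · haveI : Fact (Module.finrank ℝ (EuclideanSpace ℝ (Fin (n + 1))) = n + 1) :=
      fact_finrank_euclideanSpace_succ n
    have h1 : ‖(x : EuclideanSpace ℝ (Fin (n + 1)))‖ = 1 :=
      (mem_closedBall_zero_iff.1 x.2).antisymm (not_lt.1 hx1)
    set p : Metric.sphere (0 : EuclideanSpace ℝ (Fin (n + 1))) 1 :=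
      ⟨x, mem_sphere_zero_iff_norm.2 h1⟩ with hp
    have hxe : x ∈ (closedBallBoundaryChart p).source := by
      have := mem_chart_source (EuclideanHalfSpace (n + 1)) x
      rwa [closedBall_chartAt_of_norm_eq_one h1] at this
    exact isImmersionAtOfComplement_comp_coe_closedBall_of_charts hF (closedBallBoundaryChart p)
      (mem_insert_of_mem _ (mem_range_self p)) hxe (polarChart p) (contDiffOn_polarChart p)
      (contDiff_polarChart_symm p).contDiffOn hxe (fun z hz => hz) fun z hz =>
      coe_closedBallBoundaryChart_symm_eq_polarChart_symm p (le_of_lt hz)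

/-- **`F|𝔻ⁿ⁺¹` is an immersion of the manifold with boundary `𝔻ⁿ⁺¹` if `F : ℝⁿ⁺¹ → N` is `C^∞`
with injective differential at every point of `𝔻ⁿ⁺¹`** (Mathlib's `Manifold.IsImmersion`, models
`𝓡∂ (n + 1)` and `𝓡 m`; complement `ℝᵏ`, `k = m - (n + 1)`, from the immersion criterion
`isImmersionAtOfComplement_of_injective_mfderiv`). [cite: LeeSmoothManifolds2013, Ch. 4 Thm. 4.12 and Ch. 5 Prop. 5.22] -/
theorem isImmersion_comp_coe_closedBall_of_injective_mfderiv
    {F : EuclideanSpace ℝ (Fin (n + 1)) → N} (hF : ContMDiff (𝓡 (n + 1)) (𝓡 m) ∞ F)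
    (hd : ∀ y ∈ Metric.closedBall (0 : EuclideanSpace ℝ (Fin (n + 1))) 1,
      Injective (mfderiv (𝓡 (n + 1)) (𝓡 m) F y)) :
    Manifold.IsImmersion (𝓡∂ (n + 1)) (𝓡 m) ∞
      (F ∘ Subtype.val : Metric.closedBall (0 : EuclideanSpace ℝ (Fin (n + 1))) 1 → N) := by
  refine Manifold.IsImmersionOfComplement.isImmersion
    (F := Fin (Module.finrank ℝ (EuclideanSpace ℝ (Fin m)) -
      Module.finrank ℝ (EuclideanSpace ℝ (Fin (n + 1)))) → ℝ) fun x => ?_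
  exact isImmersionAtOfComplement_comp_coe_closedBall
    (isImmersionAtOfComplement_of_injective_mfderiv (I := 𝓡 (n + 1)) (J := 𝓡 m) isOpen_univ
      (mem_univ _) hF.contMDiffOn (by exact_mod_cast le_top) (hd x x.2))

/-- **`F|𝔻ⁿ⁺¹` is a smooth embedding of the manifold with boundary `𝔻ⁿ⁺¹`** (Mathlib's
`Manifold.IsSmoothEmbedding (𝓡∂ (n + 1)) (𝓡 m) ∞`) **if `F : ℝⁿ⁺¹ → N` is `C^∞`, injective on
`𝔻ⁿ⁺¹` and has injective differential at every point of `𝔻ⁿ⁺¹`**, `N` Hausdorff: an immersion by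
`isImmersion_comp_coe_closedBall_of_injective_mfderiv`, and a topological embedding as a continuous
injection of a compact space into a Hausdorff space (Hirsch 1976, Ch. 1 §3, Thm. 3.1). This is the
form in which the slice discs `f|𝔻²` of `Knot.IsSliceDisc` / `Knot.IsSliceDiscIn` are embedded
discs in Mathlib's sense. [cite: HirschDT1976, Ch. 1 §3 Thm. 3.1] -/
theorem isSmoothEmbedding_comp_coe_closedBall_of_injective_mfderiv [T2Space N]
    {F : EuclideanSpace ℝ (Fin (n + 1)) → N} (hF : ContMDiff (𝓡 (n + 1)) (𝓡 m) ∞ F)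
    (hinj : InjOn F (Metric.closedBall (0 : EuclideanSpace ℝ (Fin (n + 1))) 1))
    (hd : ∀ y ∈ Metric.closedBall (0 : EuclideanSpace ℝ (Fin (n + 1))) 1,
      Injective (mfderiv (𝓡 (n + 1)) (𝓡 m) F y)) :
    Manifold.IsSmoothEmbedding (𝓡∂ (n + 1)) (𝓡 m) ∞
      (F ∘ Subtype.val : Metric.closedBall (0 : EuclideanSpace ℝ (Fin (n + 1))) 1 → N) := by
  refine ⟨isImmersion_comp_coe_closedBall_of_injective_mfderiv hF hd, ?_⟩
  have hc : Continuous
      (F ∘ Subtype.val : Metric.closedBall (0 : EuclideanSpace ℝ (Fin (n + 1))) 1 → N) :=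
    hF.continuous.comp continuous_subtype_val
  have hi : Injective
      (F ∘ Subtype.val : Metric.closedBall (0 : EuclideanSpace ℝ (Fin (n + 1))) 1 → N) :=
    fun a b hab => Subtype.ext (hinj a.2 b.2 hab)
  exact (hc.isClosedEmbedding hi).isEmbedding

end ClosedBallImmersion

end Literature.Topology.FourManifolds
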